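import Summits.QuantumFields.BalabanUV.Beta.KernelWardRemainderParity
import Summits.QuantumFields.BalabanUV.Beta.WardLocusRecursive
import Summits.QuantumFields.BalabanUV.Beta.SpineRootedW2

/-!
# `BalabanUV.Beta.SpineRecursiveParity` — binder row D1, the W-side (L4) of the reflection binder hR, leaf (W-TAD) BY ROW PARITY:
# the recursively typed step family `SrecAt j` is ROW-PARITY-ODD AT EVERY LEVEL, hence every first-order tadpole against the
# sgn-symmetric step propagators `G_j` vanishes — (W-TAD-S) ∀ j, the vertex tadpoles for ALL bonds, and the Lagrangian-chart derivative
# `dM K′ N S M b` (the shape of the residual `Δ b c := dM (Ξ c) N S M b` of `SecondOrderContactAssembly.W2OfK_sharp_split`) for ANY weight kernel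
# (β sub-cell, D1 formalisation swarm seat `b2b-balaban-beta-d1-formalise-leaf-05`, gen 4; owner memo `SKELETON-D1-L4.v1` §2–§3, decision (L4-R))

HONEST FRAMING (cell contract, verbatim): «discharging `BetaPertH` makes Bałaban's UV stability UNCONDITIONAL — a real
constructive-QFT result; it is NOT the continuum limit and NOT the Clay problem.»  HONEST DEPENDENCY (cell records, verbatim):
«continuum YM on T⁴ ⇐ BetaPertH ∧ nine spine estimates (0/9 proved); BetaPertH ⇐ (D1) ∧ (D4) ∧ CAP+tail; G-an2-4 gates asym, D1 and
NE2/3/4.»  This module is [folklore] kernel algebra over tree objects BY NAME (an1's `KernelWardRemainderParity` parity calculus, leaf-10's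
`WardLocusRecursive.SrecAt`, an2's `SpineRooted.S0NAt`/`e3OfK`/`M1At`, `BubbleParity`); it types no statement of Bałaban's papers, carries
no `[cite:]` tag and no `Prop` fact, defines nothing, and instantiates NO binder of the β-function wall: it supplies the parity∕tadpole
inputs of ONE socket (`hRm0`, the tadpole-null remainder of `ChartConjugationRemainderEnd`) of ONE binder (hR).  NOT D1, NOT `BetaPertH`,
NOT continuum, NOT Clay.

ABSOLUTE RULE (cell charter, verbatim): «No internally-minted statement may enter as a cited fact. Every hypothesis is either
kernel-proved in this package or a verbatim quotation of a PUBLISHED theorem with page reference. The manuscript(s) under audit are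
NOT citable for their own disputed steps — they are the thing under adjudication; programme-internal (2001/route/tribunal) claims are
never citable.»  Every theorem below is kernel-proved from explicit hypotheses; nothing printed is used.

## What is proved (parity = `trK A = −sgnK A`: ff- and mm-blocks antisymmetric, fm-blocks symmetric under transposition)

* §1 closure of parity-oddness under scalars, negation, finite sums; under the resolvent SANDWICH `K ∘ V ∘ K` for a sgn-SYMMETRIC
  spread `K` (`trK K = sgnK K`) and a localised `V` (`parityOdd_sandwich`, by `trK_comp`, `comp_sgnK` and tame associativity); under the
  `mm`-read (`parityOdd_mmRead`).  Hence **`trK_e3OfK_of_rows`**: the generic third jet `e3OfK N K S` of a local row-parity-odd table `S`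
  over a sgn-symmetric spread `K` is row-parity-odd.
* §2 the letters: `trK_wilsonA` (an3's `wilsonA_antisymm`, ff-support), `trK_vhSAt` (an1's `vhSAt_symm`, fm∕mf-support — the NATIVE
  placement), `trK_hessFFAt` (`hessFFAt_antisymm`), `parityOdd_SLam` (any conversion coefficients), `trK_M1At`.
* §3 **`trK_SrecAt`**: for every in-block root, all coefficients `(cE, cVH, cΛ)`, GENERIC `d`, and EVERY level `j`,
  `trK (SrecAt d Lc (toSite r) cE cVH cΛ j κ u) = −sgnK (SrecAt … j κ u)` — induction through `e3OfK` from `SpineRooted.trK_S0NAt` and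
  `BubbleParity.trK_coDressKBmAt_KInvStep`; the PURE first-order tables of the (L4-D) literal in DISPLAYED form (member `0` =
  `cE • wilsonA + cVH • vhSAt ρ`, member `j+1` = `(cE·wE (j+1)) • e3OfK Lc G_j (SrecAt j) + (cVH·wVH (j+1)) • vhSAt ρ`; the (W-D)
  definition `SpureRecAt` is not filed at the time of writing) are row-parity-odd (`trK_pureZero`, `trK_pureSucc`); and
  **`parityOdd_dM`**: `dM K′ N S M μ y` is parity-odd for row-parity-odd `S`, `M` and ANY weight kernel `K′`.
* §4 (W-TAD): against `G_i := coDressKBmAt (toSite r) Lc (KInvStep Lc i)` (spread, sgn-symmetric) every localised parity-odd kernel has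
  zero tadpole (`tadpole_stepProp_eq_zero_of_parity`, an1's `tadpole_eq_zero_of_parity`); so **`tadpole_SrecAt_row_eq_zero`** (every row,
  every pair of levels `i`, `j`), `tadpole_pureZero_eq_zero` ∕ `tadpole_pureSucc_eq_zero` ((W-TAD-S) at every level),
  **`tadpole_vertexOfK_SrecAt_eq_zero`** (the one-point function `τ_b = tr (G_i ∘ V_b)` vanishes for EVERY bond `b`, not only for
  reflected ones), and **`tadpole_dM_eq_zero_of_rows`** (the residual shape `dM K′ N S M b`, any `K′`, once localised).

READING (context only, asserted nowhere below): by the owner's memo §2 the hR END consumes the second-order contact only through its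
tadpole against `G_j`; the residual `Δ b c = dM (Ξ c) N (SpureRecAt j) (M1At j) b` of the similarity-shaped letters is of the §3 shape with
`K′ := Ξ c`, so §4 feeds `hRm0` for it directly, without the decomposition into `τ_b`, `t(κ,u)`, `t^M(ρ)`.  Whether the letters ARE of
similarity shape is (W-LET), not claimed here.  Provenance: b2b-balaban β sub-cell, D1 formalisation swarm leaf-05 gen 4, 2026-08-20 (v1);
no existing file touched.
-/

noncomputable section

open Finset
open scoped BigOperators
open Literature.MathematicalPhysics.QuantumFieldTheory
open Literature.MathematicalPhysics.QuantumFieldTheory.Balaban1983to89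
open Literature.MathematicalPhysics.QuantumFieldTheory.Balaban1983to89.Beta
open ExpKernelCalculus (MKer Decays BiLoc comp tadpole)
open AffineAveraging (box toSite)
open OneStepResolventKernel (Fib wsum LocStencil)
open OneStepKernelFamily (KInvStep colH vertexOfK)
open InterLevelTransport (SLam cwsum)
open SecondOrderResponse (vertexOfM dM)
open StepJetData (wilsonA wilsonA_antisymm locStencil_wilsonA)
open AveragingHessianKernels (ell)
open AveragingHessianKernelsRooted (vhSAt vhSAt_symm locStencil_vhSAt hessFFAt hessFFAt_antisymm hessFFAt_inl_inr hessFFAt_inr)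
open BalabanStepJetsSucc (mmRead mmRead_inl_inl mmRead_inr_left mmRead_inr_right wE wVH)
open Summit.QuantumFields.BalabanUV.Beta.TameKernelCalculus
open Summit.QuantumFields.BalabanUV.Beta.BorderedHessian (sgnF sgnF_inl sgnF_inr sgnF_mul_self sgnK sgnK_apply comp_sgnK spr_sgnK)
open Summit.QuantumFields.BalabanUV.Beta.BubbleParity (sgnK_neg spr_of_decays trK_coDressKBmAt_KInvStep)
open Summit.QuantumFields.BalabanUV.Beta.VertexSandwichTransport (loc_vertexOfK)
open Summit.QuantumFields.BalabanUV.Beta.AxialDressingRooted (coDressKBmAt decays_coDressKBmAt_KInvStep)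
open Summit.QuantumFields.BalabanUV.Beta.KernelWardRelativeEnd (tadpole_eq_zero_of_parity)
open Summit.QuantumFields.BalabanUV.Beta.KernelWardRemainderParity (sgnK_add parityOdd_add parityOdd_cwsum
  trK_vertexOfK_eq_neg_sgnK_of_rows trK_vertexOfM_eq_neg_sgnK_of_rows tadpole_vertexOfK_eq_zero_of_rows)
open Summit.QuantumFields.BalabanUV.Beta.SpineRooted (S0NAt trK_S0NAt e3OfK e3OfK_apply locStencil_e3OfK M1At)
open Summit.QuantumFields.BalabanUV.Beta.WardLocusRecursive (SrecAt SrecAt_zero SrecAt_succ locStencil_SrecAt)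

namespace Summit.QuantumFields.BalabanUV.Beta.SpineRecursiveParity

variable {d : ℕ}

/-! ## §1 Closure of parity-oddness: scalars, negation, sums, the resolvent sandwich, the `mm`-read, the generic third jet -/

section Closure

/-- [folklore] `sgnK` commutes with scalars. -/
theorem sgnK_smul (c : ℝ) (A : MKer (d + 1) (Fib d)) : sgnK (c • A) = c • sgnK A := by
  funext x z a b
  simp only [sgnK_apply, Pi.smul_apply, smul_eq_mul]
  ring

/-- [folklore] `trK` commutes with scalars. -/
theorem trK_smul (c : ℝ) (A : MKer (d + 1) (Fib d)) : trK (c • A) = c • trK A := by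
  funext x z a b
  simp only [trK_apply, Pi.smul_apply]

/-- [folklore] A scalar multiple of a parity-odd kernel is parity-odd. -/
theorem parityOdd_smul (c : ℝ) {A : MKer (d + 1) (Fib d)} (h : trK A = -sgnK A) : trK (c • A) = -sgnK (c • A) := by
  rw [trK_smul, h, sgnK_smul, smul_neg]

/-- [folklore] The negation of a parity-odd kernel is parity-odd. -/
theorem parityOdd_neg {A : MKer (d + 1) (Fib d)} (h : trK A = -sgnK A) : trK (-A) = -sgnK (-A) := by
  rw [trK_neg, h, sgnK_neg]

/-- [folklore] The zero kernel is parity-odd. -/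
theorem parityOdd_zero : trK (0 : MKer (d + 1) (Fib d)) = -sgnK (0 : MKer (d + 1) (Fib d)) := by
  funext x z a b
  simp [trK_apply, sgnK_apply]

/-- [folklore] A finite sum of parity-odd kernels is parity-odd. -/
theorem parityOdd_sum {ι : Type*} (s : Finset ι) {A : ι → MKer (d + 1) (Fib d)} (h : ∀ i ∈ s, trK (A i) = -sgnK (A i)) :
    trK (∑ i ∈ s, A i) = -sgnK (∑ i ∈ s, A i) := by
  classical
  induction s using Finset.induction_on with
  | empty => rw [Finset.sum_empty]; exact parityOdd_zero
  | insert i s hi ih =>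
    rw [Finset.sum_insert hi]
    exact parityOdd_add (h i (Finset.mem_insert_self i s)) (ih fun k hk => h k (Finset.mem_insert_of_mem hk))

/-- [folklore] `sgnK` preserves the class `Loc` (`|sgnF| = 1`). -/
theorem loc_sgnK {V : MKer (d + 1) (Fib d)} (h : Loc V) : Loc (sgnK V) := by
  obtain ⟨p, q, C, δ, hδ, hV⟩ := h
  refine ⟨p, q, C, δ, hδ, fun x y a b => ?_⟩
  rw [sgnK_apply, abs_mul, abs_mul]
  have ha : |sgnF a| = 1 := by rcases a with κ | κ <;> simp
  have hb : |sgnF b| = 1 := by rcases b with κ | κ <;> simp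
  rw [ha, hb, one_mul, one_mul]
  exact hV x y a b

/-- [folklore] **THE RESOLVENT SANDWICH OF A PARITY-ODD KERNEL IS PARITY-ODD**: for a spread sgn-SYMMETRIC `K` (`trK K = sgnK K`) and a
localised parity-odd `V`, `trK (K ∘ V ∘ K) = −sgnK (K ∘ V ∘ K)` (`trK_comp`, `comp_sgnK`; tame associativity for the re-bracketing). -/
theorem parityOdd_sandwich {K V : MKer (d + 1) (Fib d)} (hKs : Spr K) (hVl : Loc V) (hKt : trK K = sgnK K) (hV : trK V = -sgnK V) :
    trK (comp (comp K V) K) = -sgnK (comp (comp K V) K) := by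
  rw [trK_comp, trK_comp, hKt, hV, comp_neg_left, comp_neg_right,
    comp_assoc_tame (spr_sgnK hKs).tame (loc_sgnK hVl).tame (spr_sgnK hKs).tame, comp_sgnK, comp_sgnK]

/-- [folklore] **THE `mm`-READ OF A PARITY-ODD KERNEL IS PARITY-ODD** (its ff-block is the antisymmetric mm-block at dilated points). -/
theorem parityOdd_mmRead (M : ℕ) {F : MKer (d + 1) (Fib d)} (h : trK F = -sgnK F) : trK (mmRead M F) = -sgnK (mmRead M F) := by
  funext x z a b
  rcases a with α | μ <;> rcases b with β | ν
  · have hF := congrFun (congrFun (congrFun (congrFun h ((M : ℤ) • x)) ((M : ℤ) • z)) (Sum.inr α)) (Sum.inr β)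
    simp only [trK_apply, Pi.neg_apply, sgnK_apply, sgnF_inr] at hF
    simp only [trK_apply, Pi.neg_apply, sgnK_apply, mmRead_inl_inl, sgnF_inl, one_mul]
    rw [hF]
    ring
  · simp [trK_apply, sgnK_apply]
  · simp [trK_apply, sgnK_apply]
  · simp [trK_apply, sgnK_apply]

/-- [folklore] The generic third jet as a kernel identity: `e3OfK N K S κ′ u′ = −mmRead N (K ∘ vertexOfK K N S κ′ u′ ∘ K)`. -/
theorem e3OfK_eq (N : ℕ) (K : MKer (d + 1) (Fib d)) (S : Fin (d + 1) → (Fin (d + 1) → ℤ) → MKer (d + 1) (Fib d))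
    (κ' : Fin (d + 1)) (u' : Fin (d + 1) → ℤ) : e3OfK N K S κ' u' = -mmRead N (comp (comp K (vertexOfK K N S κ' u')) K) := by
  funext x z a b
  rw [e3OfK_apply]
  rfl

/-- [folklore] **THE GENERIC THIRD JET OF A ROW-PARITY-ODD TABLE IS ROW-PARITY-ODD**: for a spread sgn-symmetric `K` and a local table
family `S` with `trK (S κ u) = −sgnK (S κ u)` for all rows, every row of `e3OfK N K S` is parity-odd (an1's `trK_vertexOfK_eq_neg_sgnK_of_rows`,
§1 sandwich and `mm`-read). -/
theorem trK_e3OfK_of_rows {N : ℕ} {K : MKer (d + 1) (Fib d)} (hKs : Spr K) (hKt : trK K = sgnK K)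
    {S : Fin (d + 1) → (Fin (d + 1) → ℤ) → MKer (d + 1) (Fib d)} {Cs δ : ℝ} (hS : LocStencil S Cs δ) (hδ : 0 < δ)
    (hpar : ∀ κ u, trK (S κ u) = -sgnK (S κ u)) (κ' : Fin (d + 1)) (u' : Fin (d + 1) → ℤ) :
    trK (e3OfK N K S κ' u') = -sgnK (e3OfK N K S κ' u') := by
  rw [e3OfK_eq]
  exact parityOdd_neg (parityOdd_mmRead N (parityOdd_sandwich hKs (loc_vertexOfK (N := N) hKs hS hδ κ' u') hKt
    (trK_vertexOfK_eq_neg_sgnK_of_rows K hpar κ' u')))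

end Closure

/-! ## §2 The letters: `wilsonA`, `vhSAt` (native placement), `hessFFAt`, the Λ-sector `SLam`, `M1At` -/

section Letters

/-- [folklore] **THE STRIPPED CUBIC WILSON TABLE IS ROW-PARITY-ODD**: `wilsonA d κ u` lives on the field–field block and is antisymmetric
there (an3's `StepJetData.wilsonA_antisymm`). -/
theorem trK_wilsonA (κ : Fin (d + 1)) (u : Fin (d + 1) → ℤ) : trK (wilsonA d κ u) = -sgnK (wilsonA d κ u) := by
  funext x z a b
  simp only [trK_apply, Pi.neg_apply, sgnK_apply]
  rw [wilsonA_antisymm]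
  rcases a with α | μ <;> rcases b with β | ν
  · simp only [sgnF_inl, one_mul]
  · show -(0 : ℝ) = -(sgnF (d := d) (Sum.inl α) * sgnF (d := d) (Sum.inr ν) * 0)
    simp
  · show -(0 : ℝ) = -(sgnF (d := d) (Sum.inr μ) * sgnF (d := d) (Sum.inl β) * 0)
    simp
  · show -(0 : ℝ) = -(sgnF (d := d) (Sum.inr μ) * sgnF (d := d) (Sum.inr ν) * 0)
    simp

/-- [folklore] **THE ROOTED FIELD–MULTIPLIER BORDER IN ITS NATIVE PLACEMENT IS ROW-PARITY-ODD**: `vhSAt ρ d L` lives on the fm∕mf blocks and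
is transposition-symmetric there (an1's `vhSAt_symm`), which is exactly `trK = −sgnK` on those blocks. -/
theorem trK_vhSAt (ρ : Fin (d + 1) → ℤ) (L : ℕ) (κ : Fin (d + 1)) (u : Fin (d + 1) → ℤ) :
    trK (vhSAt ρ d L rfl κ u) = -sgnK (vhSAt ρ d L rfl κ u) := by
  funext x z a b
  simp only [trK_apply, Pi.neg_apply, sgnK_apply]
  rw [← vhSAt_symm ρ L κ u x z a b]
  rcases a with α | μ <;> rcases b with β | ν
  · show (0 : ℝ) = -(sgnF (d := d) (Sum.inl α) * sgnF (d := d) (Sum.inl β) * 0)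
    simp
  · simp only [sgnF_inl, sgnF_inr]
    ring
  · simp only [sgnF_inl, sgnF_inr]
    ring
  · show (0 : ℝ) = -(sgnF (d := d) (Sum.inr μ) * sgnF (d := d) (Sum.inr ν) * 0)
    simp

/-- [folklore] **THE ROOTED W-HESSIAN TABLE OF THE CONSTRAINT IS PARITY-ODD**: `hessFFAt ρ L μ y` lives on the field–field block and is
antisymmetric there (`hessFFAt_antisymm`). -/
theorem trK_hessFFAt (ρ : Fin (d + 1) → ℤ) (L : ℕ) (μ : Fin (d + 1)) (y : Fin (d + 1) → ℤ) :
    trK (hessFFAt ρ L μ y) = -sgnK (hessFFAt ρ L μ y) := by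
  funext x z a b
  simp only [trK_apply, Pi.neg_apply, sgnK_apply]
  rw [hessFFAt_antisymm]
  rcases a with α | m <;> rcases b with β | n <;> simp

/-- [folklore] **THE Λ-SECTOR OF A PARITY-ODD SECOND-JET FAMILY IS ROW-PARITY-ODD** for ANY conversion coefficients `c`: `SLam N c Q κ u` is
(minus) a finite sum of coarse-indexed scalar superpositions of the `Q μ y` (an1's `parityOdd_cwsum`). -/
theorem parityOdd_SLam (N : ℕ) (c : Fin (d + 1) → (Fin (d + 1) → ℤ) → Fin (d + 1) → (Fin (d + 1) → ℤ) → ℝ)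
    {Q : Fin (d + 1) → (Fin (d + 1) → ℤ) → MKer (d + 1) (Fib d)} (hQ : ∀ μ y, trK (Q μ y) = -sgnK (Q μ y))
    (κ : Fin (d + 1)) (u : Fin (d + 1) → ℤ) : trK (SLam N c Q κ u) = -sgnK (SLam N c Q κ u) := by
  have h : SLam N c Q κ u = -(∑ μ : Fin (d + 1), cwsum N (fun y => c μ y κ u) (Q μ)) := by
    funext x z a b
    simp only [InterLevelTransport.SLam, Pi.neg_apply, Finset.sum_apply]
  rw [h]
  exact parityOdd_neg (parityOdd_sum _ fun μ _ => parityOdd_cwsum _ (hQ μ))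

/-- [folklore] **THE ROOTED FIRST MULTIPLIER TABLE IS ROW-PARITY-ODD**: `M1At d Lc ρ cΛ j μ w = (cΛ·wM1 j) • hessFFAt ρ Lc μ w`. -/
theorem trK_M1At {Lc : ℕ} [NeZero Lc] (ρ : Fin (d + 1) → ℤ) (cΛ : ℝ) (j : ℕ) (μ : Fin (d + 1)) (w : Fin (d + 1) → ℤ) :
    trK (M1At d Lc ρ cΛ j μ w) = -sgnK (M1At d Lc ρ cΛ j μ w) :=
  parityOdd_smul _ (trK_hessFFAt ρ Lc μ w)

end Letters

/-! ## §3 The recursive step family is row-parity-odd at every level; the pure tables; the Lagrangian-chart derivative `dM` -/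

section Family

variable {Lc : ℕ} [NeZero Lc]

/-- [folklore] **THE RECURSIVELY TYPED STEP FAMILY IS ROW-PARITY-ODD AT EVERY LEVEL**: for every in-block root `r`, all coefficients and
every `j`, `trK (SrecAt d Lc (toSite r) cE cVH cΛ j κ u) = −sgnK (SrecAt … j κ u)`.  Induction: member `0` is the native spine `S0NAt`
(`SpineRooted.trK_S0NAt`); member `j+1` = cubic sector `e3OfK Lc G_j (SrecAt j)` (§1, `G_j` spread by `decays_coDressKBmAt_KInvStep` and
sgn-symmetric by `BubbleParity.trK_coDressKBmAt_KInvStep`, `SrecAt j` local by `locStencil_SrecAt`) + border `vhSAt` + Λ-sector (§2). -/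
theorem trK_SrecAt (hLc : 1 ≤ Lc) {r : Fin (d + 1) → ℕ} (hr : r ∈ box (d + 1) Lc) (cE cVH cΛ : ℝ) :
    ∀ (j : ℕ) (κ : Fin (d + 1)) (u : Fin (d + 1) → ℤ),
      trK (SrecAt d Lc (toSite r) cE cVH cΛ j κ u) = -sgnK (SrecAt d Lc (toSite r) cE cVH cΛ j κ u)
  | 0, κ, u => by
    rw [SrecAt_zero]
    exact trK_S0NAt (toSite r) cE cVH cΛ κ u
  | j + 1, κ, u => by
    obtain ⟨Cs, δs, hδs, hS⟩ := locStencil_SrecAt hLc hr cE cVH cΛ j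
    rw [SrecAt_succ]
    exact parityOdd_add (parityOdd_add
      (parityOdd_smul _ (trK_e3OfK_of_rows (spr_of_decays (decays_coDressKBmAt_KInvStep hr j)) (trK_coDressKBmAt_KInvStep hr j)
        hS hδs (trK_SrecAt hLc hr cE cVH cΛ j) κ u))
      (parityOdd_smul _ (trK_vhSAt (toSite r) Lc κ u)))
      (parityOdd_smul _ (parityOdd_SLam _ _ (fun μ y => trK_hessFFAt (toSite r) Lc μ y) κ u))

omit [NeZero Lc] in
/-- [folklore] **THE LEVEL-`0` PURE FIRST-ORDER TABLE IS ROW-PARITY-ODD** (displayed form of the (L4-D) literal's `SpureRecAt 0`: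
`cE • wilsonA + cVH • vhSAt ρ`, any root). -/
theorem trK_pureZero (ρ : Fin (d + 1) → ℤ) (cE cVH : ℝ) (κ : Fin (d + 1)) (u : Fin (d + 1) → ℤ) :
    trK (cE • wilsonA d κ u + cVH • vhSAt ρ d Lc rfl κ u) = -sgnK (cE • wilsonA d κ u + cVH • vhSAt ρ d Lc rfl κ u) :=
  parityOdd_add (parityOdd_smul _ (trK_wilsonA κ u)) (parityOdd_smul _ (trK_vhSAt ρ Lc κ u))

/-- [folklore] **THE LEVEL-`j+1` PURE FIRST-ORDER TABLE IS ROW-PARITY-ODD** (displayed form of `SpureRecAt (j+1)`: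
`(cE·wE (j+1)) • e3OfK Lc G_j (SrecAt j) + (cVH·wVH (j+1)) • vhSAt ρ`, in-block root). -/
theorem trK_pureSucc (hLc : 1 ≤ Lc) {r : Fin (d + 1) → ℕ} (hr : r ∈ box (d + 1) Lc) (cE cVH cΛ : ℝ) (j : ℕ) (κ : Fin (d + 1))
    (u : Fin (d + 1) → ℤ) :
    trK ((cE * wE d Lc (j + 1)) • e3OfK Lc (coDressKBmAt (toSite r) Lc (KInvStep (d := d) Lc j)) (SrecAt d Lc (toSite r) cE cVH cΛ j) κ u +
        (cVH * wVH d Lc (j + 1)) • vhSAt (toSite r) d Lc rfl κ u) =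
      -sgnK ((cE * wE d Lc (j + 1)) • e3OfK Lc (coDressKBmAt (toSite r) Lc (KInvStep (d := d) Lc j)) (SrecAt d Lc (toSite r) cE cVH cΛ j) κ u +
        (cVH * wVH d Lc (j + 1)) • vhSAt (toSite r) d Lc rfl κ u) := by
  obtain ⟨Cs, δs, hδs, hS⟩ := locStencil_SrecAt hLc hr cE cVH cΛ j
  exact parityOdd_add
    (parityOdd_smul _ (trK_e3OfK_of_rows (spr_of_decays (decays_coDressKBmAt_KInvStep hr j)) (trK_coDressKBmAt_KInvStep hr j)
      hS hδs (trK_SrecAt hLc hr cE cVH cΛ j) κ u))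
    (parityOdd_smul _ (trK_vhSAt (toSite r) Lc κ u))

omit [NeZero Lc] in
/-- [folklore] **THE LAGRANGIAN-CHART BACKGROUND DERIVATIVE OF ROW-PARITY-ODD TABLES IS PARITY-ODD, FOR ANY WEIGHT KERNEL**:
`trK (dM K′ N S M μ y) = −sgnK (dM K′ N S M μ y)` whenever the rows of `S` and of `M` are parity-odd — the column weights of `K′` are scalars
(an1's `trK_vertexOfK_eq_neg_sgnK_of_rows` + `trK_vertexOfM_eq_neg_sgnK_of_rows`).  The shape of the residual `Δ b c = dM (Ξ c) N S M b`. -/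
theorem parityOdd_dM (K' : MKer (d + 1) (Fib d)) (N : ℕ) {S M : Fin (d + 1) → (Fin (d + 1) → ℤ) → MKer (d + 1) (Fib d)}
    (hS : ∀ κ u, trK (S κ u) = -sgnK (S κ u)) (hM : ∀ ρ w, trK (M ρ w) = -sgnK (M ρ w)) (μ : Fin (d + 1)) (y : Fin (d + 1) → ℤ) :
    trK (dM K' N S M μ y) = -sgnK (dM K' N S M μ y) := by
  unfold SecondOrderResponse.dM
  exact parityOdd_add (trK_vertexOfK_eq_neg_sgnK_of_rows K' hS μ y) (trK_vertexOfM_eq_neg_sgnK_of_rows K' hM μ y)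

end Family

/-! ## §4 (W-TAD): every first-order tadpole against the step propagators vanishes -/

section Tadpole

variable {Lc : ℕ} [NeZero Lc]

omit [NeZero Lc] in
/-- [folklore] Every row of a local stencil family is localised. -/
theorem loc_of_locStencil {S : Fin (d + 1) → (Fin (d + 1) → ℤ) → MKer (d + 1) (Fib d)} {Cs δ : ℝ} (hS : LocStencil S Cs δ)
    (hδ : 0 < δ) (κ : Fin (d + 1)) (u : Fin (d + 1) → ℤ) : Loc (S κ u) :=
  ⟨u, u, Cs, δ, hδ, hS κ u⟩

/-- [folklore] **A LOCALISED PARITY-ODD KERNEL HAS ZERO TADPOLE AGAINST EVERY STEP PROPAGATOR** `G_i := coDressKBmAt (toSite r) Lc (KInvStep Lc i)`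
(in-block root): `G_i` is spread (`decays_coDressKBmAt_KInvStep`) and sgn-symmetric (`BubbleParity.trK_coDressKBmAt_KInvStep`), and an1's
`KernelWardRelativeEnd.tadpole_eq_zero_of_parity` closes. -/
theorem tadpole_stepProp_eq_zero_of_parity {r : Fin (d + 1) → ℕ} (hr : r ∈ box (d + 1) Lc) (i : ℕ) {A : MKer (d + 1) (Fib d)}
    (hA : Loc A) (hpar : trK A = -sgnK A) : tadpole (coDressKBmAt (toSite r) Lc (KInvStep (d := d) Lc i)) A = 0 :=
  tadpole_eq_zero_of_parity (spr_of_decays (decays_coDressKBmAt_KInvStep hr i)) (trK_coDressKBmAt_KInvStep hr i) hA hpar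

/-- [folklore] **EVERY ROW OF THE RECURSIVE STEP FAMILY HAS ZERO TADPOLE** against every step propagator: for all levels `i`, `j` and all
rows `(κ, u)`, `tadpole G_i (SrecAt d Lc (toSite r) cE cVH cΛ j κ u) = 0`. -/
theorem tadpole_SrecAt_row_eq_zero (hLc : 1 ≤ Lc) {r : Fin (d + 1) → ℕ} (hr : r ∈ box (d + 1) Lc) (cE cVH cΛ : ℝ) (i j : ℕ)
    (κ : Fin (d + 1)) (u : Fin (d + 1) → ℤ) :
    tadpole (coDressKBmAt (toSite r) Lc (KInvStep (d := d) Lc i)) (SrecAt d Lc (toSite r) cE cVH cΛ j κ u) = 0 := by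
  obtain ⟨Cs, δs, hδs, hS⟩ := locStencil_SrecAt hLc hr cE cVH cΛ j
  exact tadpole_stepProp_eq_zero_of_parity hr i (loc_of_locStencil hS hδs κ u) (trK_SrecAt hLc hr cE cVH cΛ j κ u)

/-- [folklore] **(W-TAD-S) AT LEVEL `0`**: every row of the pure level-`0` table `cE • wilsonA + cVH • vhSAt ρ` has zero tadpole against every
step propagator (in-block root). -/
theorem tadpole_pureZero_eq_zero (hLc : 1 ≤ Lc) {r : Fin (d + 1) → ℕ} (hr : r ∈ box (d + 1) Lc) (cE cVH : ℝ) (i : ℕ) (κ : Fin (d + 1))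
    (u : Fin (d + 1) → ℤ) :
    tadpole (coDressKBmAt (toSite r) Lc (KInvStep (d := d) Lc i)) (cE • wilsonA d κ u + cVH • vhSAt (toSite r) d Lc rfl κ u) = 0 := by
  have hW : Loc (wilsonA d κ u) := loc_of_locStencil (locStencil_wilsonA (d := d) zero_le_one) one_pos κ u
  have hV : Loc (vhSAt (toSite r) d Lc rfl κ u) := loc_of_locStencil (locStencil_vhSAt hLc hr zero_le_one) one_pos κ u
  exact tadpole_stepProp_eq_zero_of_parity hr i ((hW.smul cE).add (hV.smul cVH)) (trK_pureZero (toSite r) cE cVH κ u)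

/-- [folklore] **(W-TAD-S) AT LEVEL `j+1`**: every row of the pure level-`(j+1)` table `(cE·wE (j+1)) • e3OfK Lc G_j (SrecAt j) + (cVH·wVH (j+1)) • vhSAt ρ`
has zero tadpole against every step propagator (in-block root; `e3OfK` rows local by an2's `locStencil_e3OfK`). -/
theorem tadpole_pureSucc_eq_zero (hLc : 1 ≤ Lc) {r : Fin (d + 1) → ℕ} (hr : r ∈ box (d + 1) Lc) (cE cVH cΛ : ℝ) (i j : ℕ)
    (κ : Fin (d + 1)) (u : Fin (d + 1) → ℤ) :
    tadpole (coDressKBmAt (toSite r) Lc (KInvStep (d := d) Lc i))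
      ((cE * wE d Lc (j + 1)) • e3OfK Lc (coDressKBmAt (toSite r) Lc (KInvStep (d := d) Lc j)) (SrecAt d Lc (toSite r) cE cVH cΛ j) κ u +
        (cVH * wVH d Lc (j + 1)) • vhSAt (toSite r) d Lc rfl κ u) = 0 := by
  obtain ⟨Cs, δs, hδs, hS⟩ := locStencil_SrecAt hLc hr cE cVH cΛ j
  obtain ⟨C₁, δ₁, hδ₁, h1⟩ := locStencil_e3OfK (N := Lc) hLc (decays_coDressKBmAt_KInvStep (d := d) hr j) hS hδs
  have hE := loc_of_locStencil h1 hδ₁ κ u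
  have hV : Loc (vhSAt (toSite r) d Lc rfl κ u) := loc_of_locStencil (locStencil_vhSAt hLc hr zero_le_one) one_pos κ u
  exact tadpole_stepProp_eq_zero_of_parity hr i ((hE.smul _).add (hV.smul _)) (trK_pureSucc hLc hr cE cVH cΛ j κ u)

/-- [folklore] **THE ONE-POINT FUNCTION OF THE RECURSIVE FAMILY VANISHES FOR EVERY BOND**: `tadpole G_i (vertexOfK G_j Lc (SrecAt … j) μ y) = 0`
for all levels `i`, `j` and ALL coarse bonds `(μ, y)` — the chain-rule vertex of a row-parity-odd local table is parity-odd and localised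
(an1's `trK_vertexOfK_eq_neg_sgnK_of_rows`, an3's `loc_vertexOfK`). -/
theorem tadpole_vertexOfK_SrecAt_eq_zero (hLc : 1 ≤ Lc) {r : Fin (d + 1) → ℕ} (hr : r ∈ box (d + 1) Lc) (cE cVH cΛ : ℝ) (i j : ℕ)
    (μ : Fin (d + 1)) (y : Fin (d + 1) → ℤ) :
    tadpole (coDressKBmAt (toSite r) Lc (KInvStep (d := d) Lc i))
      (vertexOfK (coDressKBmAt (toSite r) Lc (KInvStep (d := d) Lc j)) Lc (SrecAt d Lc (toSite r) cE cVH cΛ j) μ y) = 0 := by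
  obtain ⟨Cs, δs, hδs, hS⟩ := locStencil_SrecAt hLc hr cE cVH cΛ j
  exact tadpole_stepProp_eq_zero_of_parity hr i
    (loc_vertexOfK (N := Lc) (spr_of_decays (decays_coDressKBmAt_KInvStep hr j)) hS hδs μ y)
    (trK_vertexOfK_eq_neg_sgnK_of_rows _ (trK_SrecAt hLc hr cE cVH cΛ j) μ y)

/-- [folklore] The same at equal levels, in the literal shape of an1's `tadpole_vertexOfK_eq_zero_of_rows`: `τ_b := tadpole G_j (V_j b) = 0` for
every bond `b`, `V_j b = vertexOfK G_j Lc (SrecAt … j) b`. -/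
theorem tadpole_vertexOfK_SrecAt_eq_zero' (hLc : 1 ≤ Lc) {r : Fin (d + 1) → ℕ} (hr : r ∈ box (d + 1) Lc) (cE cVH cΛ : ℝ) (j : ℕ)
    (μ : Fin (d + 1)) (y : Fin (d + 1) → ℤ) :
    tadpole (coDressKBmAt (toSite r) Lc (KInvStep (d := d) Lc j))
      (vertexOfK (coDressKBmAt (toSite r) Lc (KInvStep (d := d) Lc j)) Lc (SrecAt d Lc (toSite r) cE cVH cΛ j) μ y) = 0 := by
  obtain ⟨Cs, δs, hδs, hS⟩ := locStencil_SrecAt hLc hr cE cVH cΛ j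
  exact tadpole_vertexOfK_eq_zero_of_rows (spr_of_decays (decays_coDressKBmAt_KInvStep hr j)) (trK_coDressKBmAt_KInvStep hr j) hS hδs
    (trK_SrecAt hLc hr cE cVH cΛ j) μ y

omit [NeZero Lc] in
/-- [folklore] **THE RESIDUAL SHAPE HAS ZERO TADPOLE**: for a spread sgn-symmetric `G`, row-parity-odd tables `S`, `M`, ANY weight kernel `K′`,
and any bond, `tadpole G (dM K′ N S M μ y) = 0` once `dM K′ N S M μ y` is localised (e.g. `SecondOrderTransport.loc_dM` for a decaying `K′`)
— the socket `hRm0` of `ChartConjugationRemainderEnd` for remainders of the shape `Δ b c = dM (Ξ c) N S M b`. -/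
theorem tadpole_dM_eq_zero_of_rows {G : MKer (d + 1) (Fib d)} (hG : Spr G) (hGt : trK G = sgnK G) (K' : MKer (d + 1) (Fib d)) (N : ℕ)
    {S M : Fin (d + 1) → (Fin (d + 1) → ℤ) → MKer (d + 1) (Fib d)} (hS : ∀ κ u, trK (S κ u) = -sgnK (S κ u))
    (hM : ∀ ρ w, trK (M ρ w) = -sgnK (M ρ w)) (μ : Fin (d + 1)) (y : Fin (d + 1) → ℤ) (hl : Loc (dM K' N S M μ y)) :
    tadpole G (dM K' N S M μ y) = 0 :=
  tadpole_eq_zero_of_parity hG hGt hl (parityOdd_dM K' N hS hM μ y)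

/-- [folklore] **THE WALL INSTANCE OF THE RESIDUAL SHAPE**: against `G_i`, for the recursive family's tables `SrecAt … j` and the rooted first
multiplier table `M1At … j′`, any weight kernel `K′`, any bond — zero tadpole once localised. -/
theorem tadpole_dM_SrecAt_M1At_eq_zero (hLc : 1 ≤ Lc) {r : Fin (d + 1) → ℕ} (hr : r ∈ box (d + 1) Lc) (cE cVH cΛ cΛ' : ℝ) (i j j' : ℕ)
    (K' : MKer (d + 1) (Fib d)) (μ : Fin (d + 1)) (y : Fin (d + 1) → ℤ)
    (hl : Loc (dM K' Lc (SrecAt d Lc (toSite r) cE cVH cΛ j) (M1At d Lc (toSite r) cΛ' j') μ y)) :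
    tadpole (coDressKBmAt (toSite r) Lc (KInvStep (d := d) Lc i))
      (dM K' Lc (SrecAt d Lc (toSite r) cE cVH cΛ j) (M1At d Lc (toSite r) cΛ' j') μ y) = 0 :=
  tadpole_dM_eq_zero_of_rows (spr_of_decays (decays_coDressKBmAt_KInvStep hr i)) (trK_coDressKBmAt_KInvStep hr i) K' Lc
    (trK_SrecAt hLc hr cE cVH cΛ j) (fun ρ w => trK_M1At (toSite r) cΛ' j' ρ w) μ y hl

end Tadpole

end Summit.QuantumFields.BalabanUV.Beta.SpineRecursiveParity

end
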